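import Literature.MathematicalPhysics.KineticTheory.SiteChainLangevinKernel
import Literature.MathematicalPhysics.KineticTheory.LangevinChainExpBound
import Literature.MathematicalPhysics.KineticTheory.SdeGeneratorCalculus
import HarnessLib

/-!
# The reversed generator of a site-inhomogeneous Langevin chain on functions of the energy

Topic `Literature/MathematicalPhysics/KineticTheory`, grouping namespace `…KineticTheory.HeatConduction`.
Twin, for the site-dependent chains `SiteChain` of `CellChain.lean` (drift `SiteChain.langevinDrift`,
bath directions `SiteChain.noiseVecL/R` of `SiteChainLangevinKernel.lean`), of the computation (3.3)
of Cuneo–Eckmann–Hairer–Rey-Bellet 2018 for a general function `F∘H` of the energy, and of its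
momentum-reversed version used by the backward (transposed) Kolmogorov equation:

* `SiteChain.generator_comp_hamiltonian_qp` — `L(F∘H) = γ ∑_b (T_b (F''(H) p_b² + F'(H)) - F'(H) p_b²)`
  (the Hamiltonian part of the generator annihilates functions of `H`);
* `SiteChain.sdeGenerator_negLangevinDrift_comp_hamiltonian(_sum)` — for the generator
  `L̂ f = Df·(-Y) + ½ ∑_b D²f[v_b, v_b]` of the momentum-REVERSED drift `-Y` (`L̂ + 2γ = Lᵀ`, the
  Lebesgue transpose of `L`): `L̂(F∘H) = γ ∑_b (T_b (F''(H) p_b² + F'(H)) + F'(H) p_b²)` (reversing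
  the friction flips the sign of `γ p_b ∂_{p_b}`), indicator-sum and closed two-bath forms;
* `SiteChain.abs_sdeGenerator_negLangevinDrift_comp_hamiltonian_le` — the bound
  `|L̂(F∘H)| ≤ γ (A₁ + A₂)(T_L + T_R + 2)(1 + p_0² + p_{N-1}²) E` when `|F'(H)| ≤ A₁ E`,
  `|F''(H)| ≤ A₂ E`.

## References

* N. Cuneo, J.-P. Eckmann, M. Hairer, L. Rey-Bellet, *Non-equilibrium steady states for networks of
  oscillators*, Electron. J. Probab. **23** (2018) no. 55, §3 eq. (3.2)–(3.3), §3.1 (`L*`).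
* U. G. Haussmann, É. Pardoux, *Time reversal of diffusions*, Ann. Probab. **14** (1986) 1188–1205.

## Design choices

* Differentiable site potentials only (`hU`, `hV` sitewise); the chain rule along the coordinate
  directions is written at a point `(q, p)`.
* NOT here: kernels, cutoffs, the backward identity (`SiteChainResponseBackward*.lean`).
-/

noncomputable section

open MeasureTheory Filter Topology Set
open scoped ContDiff NNReal

namespace Literature.MathematicalPhysics.KineticTheory.HeatConduction

open Literature.MathematicalPhysics.KineticTheory

variable {N : ℕ}

namespace SiteChain

variable (P : SiteChain)

/-! ### The chain rule along the coordinate directions for `F∘H` -/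

/-- `∂_{p_i} F(H) = F'(H) p_i` as a line derivative at `(q, p)` (no hypothesis on the potentials).
[folklore] -/
theorem hasLineDerivAt_comp_hamiltonian_unitP {F F' : ℝ → ℝ} (hF : ∀ u, HasDerivAt F (F' u) u)
    (N : ℕ) (q p : Fin N → ℝ) (i : Fin N) :
    HasLineDerivAt ℝ (fun y => F (P.hamiltonian N y)) (F' (P.hamiltonian N (q, p)) * p i) (q, p)
      ((0, Pi.single i 1) : PhaseSpace N) := by
  have h := P.hasLineDerivAt_hamiltonian_unitP N q p i
  unfold HasLineDerivAt at h ⊢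
  have := (hF _).comp 0 h
  simpa [Function.comp_def] using this

/-- `∂_{q_i} F(H) = F'(H) ∂_{q_i}H` as a line derivative at `(q, p)`, for a differentiable energy.
[folklore] -/
theorem hasLineDerivAt_comp_hamiltonian_unitQ (hH : Differentiable ℝ (P.hamiltonian N))
    {F F' : ℝ → ℝ} (hF : ∀ u, HasDerivAt F (F' u) u) (q p : Fin N → ℝ) (i : Fin N) :
    HasLineDerivAt ℝ (fun y => F (P.hamiltonian N y))
      (F' (P.hamiltonian N (q, p)) * partialQ i (P.hamiltonian N) (q, p)) (q, p)
      ((Pi.single i 1, 0) : PhaseSpace N) := by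
  have h := hasLineDerivAt_partialQ hH i (q, p)
  unfold HasLineDerivAt at h ⊢
  have := (hF _).comp 0 h
  simpa [Function.comp_def] using this

/-- `∂_{p_i} F(H) (q, p) = F'(H(q, p)) p_i`. [folklore] -/
theorem partialP_comp_hamiltonian_qp {F F' : ℝ → ℝ} (hF : ∀ u, HasDerivAt F (F' u) u) (N : ℕ)
    (q p : Fin N → ℝ) (i : Fin N) :
    partialP i (fun y => F (P.hamiltonian N y)) (q, p) = F' (P.hamiltonian N (q, p)) * p i := by
  rw [partialP_eq_lineDeriv, (P.hasLineDerivAt_comp_hamiltonian_unitP hF N q p i).lineDeriv]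

/-- `∂_{q_i} F(H) (q, p) = F'(H(q, p)) ∂_{q_i} H (q, p)`. [folklore] -/
theorem partialQ_comp_hamiltonian_qp (hH : Differentiable ℝ (P.hamiltonian N)) {F F' : ℝ → ℝ}
    (hF : ∀ u, HasDerivAt F (F' u) u) (q p : Fin N → ℝ) (i : Fin N) :
    partialQ i (fun y => F (P.hamiltonian N y)) (q, p) =
      F' (P.hamiltonian N (q, p)) * partialQ i (P.hamiltonian N) (q, p) := by
  rw [partialQ_eq_lineDeriv, (P.hasLineDerivAt_comp_hamiltonian_unitQ hH hF q p i).lineDeriv]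

/-- `∂_{p_i} (F'(H) p_i) (q, p) = F''(H) p_i² + F'(H)`. [folklore] -/
theorem partialP_deriv_comp_hamiltonian_mul_qp {F' F'' : ℝ → ℝ} (hF' : ∀ u, HasDerivAt F' (F'' u) u)
    (N : ℕ) (q p : Fin N → ℝ) (i : Fin N) :
    partialP i (fun y => F' (P.hamiltonian N y) * y.2 i) (q, p) =
      F'' (P.hamiltonian N (q, p)) * p i ^ 2 + F' (P.hamiltonian N (q, p)) := by
  rw [partialP_eq_lineDeriv]
  have h1 : HasLineDerivAt ℝ (fun y : PhaseSpace N => y.2 i) 1 (q, p)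
      ((0, Pi.single i 1) : PhaseSpace N) := by
    unfold HasLineDerivAt
    simp only [add_smul_unitP_snd, Pi.add_apply, Pi.smul_apply, Pi.single_eq_same, smul_eq_mul,
      mul_one]
    simpa using (hasDerivAt_id (0 : ℝ)).const_add (p i)
  have h2 := P.hasLineDerivAt_comp_hamiltonian_unitP hF' N q p i
  have h12 : HasLineDerivAt ℝ (fun y : PhaseSpace N => F' (P.hamiltonian N y) * y.2 i)
      (F'' (P.hamiltonian N (q, p)) * p i * p i + F' (P.hamiltonian N (q, p)) * 1) (q, p)
      ((0, Pi.single i 1) : PhaseSpace N) := by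
    unfold HasLineDerivAt at h1 h2 ⊢
    have := h2.mul h1
    simpa [Pi.mul_def] using this
  rw [h12.lineDeriv]
  ring

/-- **The generator of a site-dependent chain applied to a function of the energy** (CEHR (3.3) for
a general `F∘H`), at a point `(q, p)`: the Hamiltonian part drops out and each bath contributes
`γ (T_b ∂²_{p_b} - p_b ∂_{p_b}) F(H) = γ (T_b (F''(H) p_b² + F'(H)) - F'(H) p_b²)`.
[cite: CuneoEckmannHairerReyBellet2018, §3 eq. (3.3)] -/
theorem generator_comp_hamiltonian_qp (hH : Differentiable ℝ (P.hamiltonian N)) {F F' F'' : ℝ → ℝ}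
    (hF : ∀ u, HasDerivAt F (F' u) u) (hF' : ∀ u, HasDerivAt F' (F'' u) u) (T_L T_R : ℝ)
    (q p : Fin N → ℝ) :
    P.generator N T_L T_R (fun y => F (P.hamiltonian N y)) (q, p) =
      P.γ * ∑ i : Fin N,
        ((if i.val = 0 then T_L * (F'' (P.hamiltonian N (q, p)) * p i ^ 2 + F' (P.hamiltonian N (q, p))) -
            F' (P.hamiltonian N (q, p)) * p i ^ 2 else 0) +
          (if i.val = N - 1 then
            T_R * (F'' (P.hamiltonian N (q, p)) * p i ^ 2 + F' (P.hamiltonian N (q, p))) -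
              F' (P.hamiltonian N (q, p)) * p i ^ 2 else 0)) := by
  have hPfun : ∀ i : Fin N, partialP i (fun y => F (P.hamiltonian N y)) =
      fun y => F' (P.hamiltonian N y) * y.2 i := fun i => by
    funext y
    exact P.partialP_comp_hamiltonian_qp hF N y.1 y.2 i
  simp only [generator, hPfun, P.partialQ_comp_hamiltonian_qp hH hF,
    P.partialP_deriv_comp_hamiltonian_mul_qp hF']
  have h0 : ∀ i : Fin N, p i * (F' (P.hamiltonian N (q, p)) * partialQ i (P.hamiltonian N) (q, p)) -
      partialQ i (P.hamiltonian N) (q, p) * (F' (P.hamiltonian N (q, p)) * p i) = 0 := fun i => by ring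
  simp only [h0, Finset.sum_const_zero, zero_add]
  congr 1
  refine Finset.sum_congr rfl fun i _ => ?_
  split_ifs <;> ring

/-! ### The reversed generator of a function of the energy -/

/-- **The generator of the momentum-reversed Langevin drift of a site-dependent chain on a function
of the energy** (indicator-sum form): with `L̂ f = Df·(-Y) + ½ ∑_b D²f[v_b, v_b]`
(`Y = P.langevinDrift N`, `v_b = P.noiseVecL/R`; `L̂ + 2γ = Lᵀ`),
`L̂(F∘H) = γ ∑_i ([i=0](T_L (F''(H) p_i² + F'(H)) + F'(H) p_i²) + [i=N-1](T_R (…) + F'(H) p_i²))`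
(`N ≥ 1`, `γT_L, γT_R ≥ 0`, `C¹` site potentials, `H, F ∈ C²`). [folklore] -/
theorem sdeGenerator_negLangevinDrift_comp_hamiltonian_sum (hN : 0 < N) {T_L T_R : ℝ}
    (hL : 0 ≤ P.γ * T_L) (hR : 0 ≤ P.γ * T_R) (hU : ∀ i, ContDiff ℝ 1 (P.U i))
    (hV : ∀ i, ContDiff ℝ 1 (P.V i)) (hH : ContDiff ℝ 2 (P.hamiltonian N))
    {F F' F'' : ℝ → ℝ} (hFc : ContDiff ℝ 2 F) (hF : ∀ u, HasDerivAt F (F' u) u)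
    (hF' : ∀ u, HasDerivAt F' (F'' u) u) (x : PhaseSpace N) :
    sdeGenerator (fun y => -P.langevinDrift N y) (P.noiseVecL N T_L) (P.noiseVecR N T_R)
        (fun y => F (P.hamiltonian N y)) x =
      P.γ * ∑ i : Fin N,
        ((if i.val = 0 then T_L * (F'' (P.hamiltonian N x) * x.2 i ^ 2 + F' (P.hamiltonian N x)) +
            F' (P.hamiltonian N x) * x.2 i ^ 2 else 0) +
          (if i.val = N - 1 then
            T_R * (F'' (P.hamiltonian N x) * x.2 i ^ 2 + F' (P.hamiltonian N x)) +
              F' (P.hamiltonian N x) * x.2 i ^ 2 else 0)) := by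
  set H := P.hamiltonian N with hHdef
  have hHd : Differentiable ℝ H := hH.differentiable (by norm_num)
  have hf2 : ContDiff ℝ 2 (fun y => F (H y)) := hFc.comp hH
  -- reversing the drift: `L̂ f = L f - 2 Df·Y`
  have h1 : sdeGenerator (fun y => -P.langevinDrift N y) (P.noiseVecL N T_L) (P.noiseVecR N T_R)
        (fun y => F (H y)) x =
      sdeGenerator (P.langevinDrift N) (P.noiseVecL N T_L) (P.noiseVecR N T_R) (fun y => F (H y)) x -
        2 * fderiv ℝ (fun y => F (H y)) x (P.langevinDrift N x) := by
    simp only [sdeGenerator_def, map_neg]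
    ring
  -- chain rule
  have h2 : fderiv ℝ (fun y => F (H y)) x (P.langevinDrift N x) =
      F' (H x) * fderiv ℝ H x (P.langevinDrift N x) := by
    have hc : HasFDerivAt (fun y => F (H y)) (F' (H x) • fderiv ℝ H x) x :=
      (hF (H x)).comp_hasFDerivAt x (hHd x).hasFDerivAt
    rw [hc.fderiv]
    rfl
  -- the energy identity with zero forcing: `DH·Y = -γ ∑_b p_b²`
  have h3 : fderiv ℝ H x (P.langevinDrift N x) =
      ∑ i, (-(P.γ * OscillatorChain.bathWeight N i * x.2 i ^ 2)) := by
    have h := P.fderiv_hamiltonian_drift_eq_sum hU hV x 0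
    have hx : ((x.1, x.2 + 0) : PhaseSpace N) = x := by simp
    rw [hx] at h
    rw [h]
    exact Finset.sum_congr rfl fun i _ => by simp
  have hgen : P.generator N T_L T_R (fun y => F (H y)) x =
      P.γ * ∑ i : Fin N,
        ((if i.val = 0 then T_L * (F'' (H x) * x.2 i ^ 2 + F' (H x)) - F' (H x) * x.2 i ^ 2 else 0) +
          (if i.val = N - 1 then T_R * (F'' (H x) * x.2 i ^ 2 + F' (H x)) - F' (H x) * x.2 i ^ 2
            else 0)) :=
    P.generator_comp_hamiltonian_qp hHd hF hF' T_L T_R x.1 x.2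
  rw [h1, congrFun (P.sdeGenerator_langevinDrift_eq_generator hN hL hR hf2) x, hgen, h2, h3]
  have e3 : (2 : ℝ) * (F' (H x) * ∑ i : Fin N, -(P.γ * OscillatorChain.bathWeight N i * x.2 i ^ 2)) =
      P.γ * ∑ i : Fin N, (-(2 * F' (H x) * OscillatorChain.bathWeight N i * x.2 i ^ 2)) := by
    rw [Finset.mul_sum Finset.univ _ (P.γ), Finset.mul_sum Finset.univ _ (F' (H x)),
      Finset.mul_sum Finset.univ _ (2 : ℝ)]
    exact Finset.sum_congr rfl fun i _ => by ring
  rw [e3, ← mul_sub, ← Finset.sum_sub_distrib]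
  congr 1
  refine Finset.sum_congr rfl fun i _ => ?_
  unfold OscillatorChain.bathWeight
  split_ifs <;> ring

/-- **The reversed generator on a function of the energy, closed form** (`N ≥ 1`; for `N = 1` both
baths sit on the single site):
`L̂(F∘H) = γ (T_L (F''(H) p_0² + F'(H)) + F'(H) p_0² + T_R (F''(H) p_{N-1}² + F'(H)) + F'(H) p_{N-1}²)`.
[folklore] -/
theorem sdeGenerator_negLangevinDrift_comp_hamiltonian (hN : 0 < N) {T_L T_R : ℝ}
    (hL : 0 ≤ P.γ * T_L) (hR : 0 ≤ P.γ * T_R) (hU : ∀ i, ContDiff ℝ 1 (P.U i))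
    (hV : ∀ i, ContDiff ℝ 1 (P.V i)) (hH : ContDiff ℝ 2 (P.hamiltonian N))
    {F F' F'' : ℝ → ℝ} (hFc : ContDiff ℝ 2 F) (hF : ∀ u, HasDerivAt F (F' u) u)
    (hF' : ∀ u, HasDerivAt F' (F'' u) u) (x : PhaseSpace N) :
    sdeGenerator (fun y => -P.langevinDrift N y) (P.noiseVecL N T_L) (P.noiseVecR N T_R)
        (fun y => F (P.hamiltonian N y)) x =
      P.γ * ((T_L * (F'' (P.hamiltonian N x) * x.2 ⟨0, hN⟩ ^ 2 + F' (P.hamiltonian N x)) +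
          F' (P.hamiltonian N x) * x.2 ⟨0, hN⟩ ^ 2) +
        (T_R * (F'' (P.hamiltonian N x) * x.2 ⟨N - 1, by omega⟩ ^ 2 + F' (P.hamiltonian N x)) +
          F' (P.hamiltonian N x) * x.2 ⟨N - 1, by omega⟩ ^ 2)) := by
  rw [P.sdeGenerator_negLangevinDrift_comp_hamiltonian_sum hN hL hR hU hV hH hFc hF hF' x,
    Finset.sum_add_distrib]
  congr 1
  have e1 : ∑ i : Fin N, (if i.val = 0 then
      T_L * (F'' (P.hamiltonian N x) * x.2 i ^ 2 + F' (P.hamiltonian N x)) +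
        F' (P.hamiltonian N x) * x.2 i ^ 2 else 0) =
      T_L * (F'' (P.hamiltonian N x) * x.2 ⟨0, hN⟩ ^ 2 + F' (P.hamiltonian N x)) +
        F' (P.hamiltonian N x) * x.2 ⟨0, hN⟩ ^ 2 := by
    rw [Finset.sum_eq_single_of_mem (⟨0, hN⟩ : Fin N) (Finset.mem_univ _)]
    · simp
    · intro j _ hj
      rw [if_neg]
      exact fun h => hj (Fin.ext h)
  have e2 : ∑ i : Fin N, (if i.val = N - 1 then
      T_R * (F'' (P.hamiltonian N x) * x.2 i ^ 2 + F' (P.hamiltonian N x)) +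
        F' (P.hamiltonian N x) * x.2 i ^ 2 else 0) =
      T_R * (F'' (P.hamiltonian N x) * x.2 ⟨N - 1, by omega⟩ ^ 2 + F' (P.hamiltonian N x)) +
        F' (P.hamiltonian N x) * x.2 ⟨N - 1, by omega⟩ ^ 2 := by
    rw [Finset.sum_eq_single_of_mem (⟨N - 1, by omega⟩ : Fin N) (Finset.mem_univ _)]
    · simp
    · intro j _ hj
      rw [if_neg]
      exact fun h => hj (Fin.ext h)
  rw [e1, e2]

/-- **Exponential-type bound of the reversed generator on a function of the energy.** If
`|F'(H(x))| ≤ A₁ E` and `|F''(H(x))| ≤ A₂ E` (`γ, T_L, T_R ≥ 0`), then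
`|L̂(F∘H)(x)| ≤ γ (A₁ + A₂) (T_L + T_R + 2) (1 + p_0² + p_{N-1}²) E`. [folklore] -/
theorem abs_sdeGenerator_negLangevinDrift_comp_hamiltonian_le (hN : 0 < N) (hγ : 0 ≤ P.γ)
    {T_L T_R : ℝ} (hTL : 0 ≤ T_L) (hTR : 0 ≤ T_R) (hU : ∀ i, ContDiff ℝ 1 (P.U i))
    (hV : ∀ i, ContDiff ℝ 1 (P.V i)) (hH : ContDiff ℝ 2 (P.hamiltonian N))
    {F F' F'' : ℝ → ℝ} (hFc : ContDiff ℝ 2 F) (hF : ∀ u, HasDerivAt F (F' u) u)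
    (hF' : ∀ u, HasDerivAt F' (F'' u) u) (x : PhaseSpace N) {A₁ A₂ E : ℝ}
    (h1 : |F' (P.hamiltonian N x)| ≤ A₁ * E) (h2 : |F'' (P.hamiltonian N x)| ≤ A₂ * E) :
    |sdeGenerator (fun y => -P.langevinDrift N y) (P.noiseVecL N T_L) (P.noiseVecR N T_R)
        (fun y => F (P.hamiltonian N y)) x| ≤
      P.γ * ((A₁ + A₂) * (T_L + T_R + 2) *
        (1 + x.2 ⟨0, hN⟩ ^ 2 + x.2 ⟨N - 1, by omega⟩ ^ 2) * E) := by
  rw [P.sdeGenerator_negLangevinDrift_comp_hamiltonian hN (mul_nonneg hγ hTL) (mul_nonneg hγ hTR)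
    hU hV hH hFc hF hF' x, abs_mul, abs_of_nonneg hγ]
  refine mul_le_mul_of_nonneg_left ?_ hγ
  set b := F' (P.hamiltonian N x)
  set c := F'' (P.hamiltonian N x)
  set p := x.2 ⟨0, hN⟩
  set q := x.2 ⟨N - 1, by omega⟩
  have hA₁ : 0 ≤ A₁ * E := (abs_nonneg _).trans h1
  have hA₂ : 0 ≤ A₂ * E := (abs_nonneg _).trans h2
  have hp : 0 ≤ p ^ 2 := sq_nonneg p
  have hq : 0 ≤ q ^ 2 := sq_nonneg q
  -- one bath term
  have hterm : ∀ (T : ℝ), 0 ≤ T → ∀ (r : ℝ),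
      |T * (c * r ^ 2 + b) + b * r ^ 2| ≤ (A₁ * E + A₂ * E) * (T + 1) * (1 + r ^ 2) := by
    intro T hT r
    have hr : 0 ≤ r ^ 2 := sq_nonneg r
    have hb : |b| ≤ A₁ * E := h1
    have hc : |c| ≤ A₂ * E := h2
    calc |T * (c * r ^ 2 + b) + b * r ^ 2|
        ≤ |T * (c * r ^ 2 + b)| + |b * r ^ 2| := abs_add_le _ _
      _ = T * |c * r ^ 2 + b| + |b| * r ^ 2 := by
          rw [abs_mul, abs_of_nonneg hT, abs_mul, abs_of_nonneg hr]
      _ ≤ T * (|c| * r ^ 2 + |b|) + |b| * r ^ 2 := by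
          refine add_le_add (mul_le_mul_of_nonneg_left ?_ hT) le_rfl
          calc |c * r ^ 2 + b| ≤ |c * r ^ 2| + |b| := abs_add_le _ _
            _ = |c| * r ^ 2 + |b| := by rw [abs_mul, abs_of_nonneg hr]
      _ ≤ T * (A₂ * E * r ^ 2 + A₁ * E) + A₁ * E * r ^ 2 := by
          refine add_le_add (mul_le_mul_of_nonneg_left (add_le_add
            (mul_le_mul_of_nonneg_right hc hr) hb) hT) (mul_le_mul_of_nonneg_right hb hr)
      _ ≤ (A₁ * E + A₂ * E) * (T + 1) * (1 + r ^ 2) := by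
          nlinarith [mul_nonneg hA₁ hr, mul_nonneg hA₂ hr, mul_nonneg hT hr,
            mul_nonneg (mul_nonneg hT hr) hA₁, mul_nonneg (mul_nonneg hT hr) hA₂,
            mul_nonneg hT hA₁, mul_nonneg hT hA₂]
  have hL' := hterm T_L hTL p
  have hR' := hterm T_R hTR q
  calc |T_L * (c * p ^ 2 + b) + b * p ^ 2 + (T_R * (c * q ^ 2 + b) + b * q ^ 2)|
      ≤ |T_L * (c * p ^ 2 + b) + b * p ^ 2| + |T_R * (c * q ^ 2 + b) + b * q ^ 2| := abs_add_le _ _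
    _ ≤ (A₁ * E + A₂ * E) * (T_L + 1) * (1 + p ^ 2) + (A₁ * E + A₂ * E) * (T_R + 1) * (1 + q ^ 2) :=
        add_le_add hL' hR'
    _ ≤ (A₁ + A₂) * (T_L + T_R + 2) * (1 + p ^ 2 + q ^ 2) * E := by
        have hAE : 0 ≤ A₁ * E + A₂ * E := add_nonneg hA₁ hA₂
        nlinarith [mul_nonneg hAE hp, mul_nonneg hAE hq, mul_nonneg (mul_nonneg hAE hTL) hq,
          mul_nonneg (mul_nonneg hAE hTR) hp, mul_nonneg hAE hTL, mul_nonneg hAE hTR]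

end SiteChain

end Literature.MathematicalPhysics.KineticTheory.HeatConduction
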